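import Summits.Ventures.YMGap.RobustBall.UniformMassGap
import Summits.Ventures.YMGap.RobustBall.MassGapOnBallZdGRows
import HarnessLib

/-!
# Venture YMGap, track ROBUST-BALL (Y2) — the mass gap UNIFORMLY on the gauge-invariant `ℤ^d` ball through ds-2's
# robust star door: explicit rate and constant

HONEST FRAMING. WHAT THIS IS: a venture file (cell `pub-ymgap`, track Y2 ROBUST-BALL, seat rb-p1, theorems
only) closing the uniform gauge-ball currency `UniformMassGapOnBallZdG` of `UniformMassGap.lean` with ds-2's
landed robust vertex-star door on `ℤ^d` (`RobustStarDoorZd.lean`, `StarDoorZdPerturbed.lean`, `StarDoorZd.lean`),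
whose constants are explicit and member-independent:
* `StarWindowBoundZdR.mono_rho` — the star window bound is monotone in the received sum;
* `perturbedClustering_of_starWindowBoundZdR` — a star window bound with locality radius `D ≥ R + 2` and received
  sum `0 ≤ ρ < 1` gives `PerturbedClustering` with rate `starRate d ρ/(D+2)` and constant `16N e^{starRate d ρ}`
  (`abs_covariance_le_of_starWindowBoundZdR`; the landed `perturbedMassGapAt_of_starWindowBoundZdR` hides these
  behind `∃`);
* `uniformMassGapOnBallZdG_of_robustStar` — under EXACTLY the hypotheses of ds-2's `massGapOnBallZdG_of_robustStar`
  plus a round bound `ρ ≤ ρ₀ < 1`: `UniformMassGapOnBallZdG d N β ε₀ ε₁ R (starRate d ρ₀/(max R 1 + 4)) (32N)`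
  (`e^{starRate} ≤ e^{1/2} ≤ 2`);
* `SU(2)`, `d = 4`, quarter modulus (ds-2's schema `su2_massGapOnBallZdG_star` followed line by line):
  `su2_uniformMassGapOnBallZdG_star`; CELLS with a legible rate — quarter radius at `β_W = 1/8`:
  `su2_uniformStar_oneEighth_quarterRadius (R) : UniformMassGapOnBallZdG 4 2 (1/32) (37/500) (37/1000) R ((1/32)/(max R 1 + 4)) 64`
  (received sum `≤ 7/20`), half radius at `β_W = 1/8` (`(37/250, 37/500)`, `ρ₀ = 13/25`, rate `(1/81)/(max R 1 + 4)`),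
  half radius at `β_W = 1/4` (`(11/200, 11/400)`, `ρ₀ = 3/4`, rate `(1/416)/(max R 1 + 4)`), and the Wilson points
  `β_W = 1/8, 1/4, 1/3` (radius `0`: rates `(961/14720)/5`, `(81/7840)/5`, `(1/1920)/5` at `R = 0`);
* the six landed FRONTIER cells of `MassGapOnBallZdGRows.lean` (`(1/8,.148) … (1/3,.012)`) re-read uniformly in the
  form `∃ m > 0, ∀ R, UniformMassGapOnBallZdG 4 2 β ε₀ ε₁ R (m/(max R 1 + 4)) 64` (`su2_uniformStar_frontier_*`,
  `su2_uniformStar_upTo_oneThird`):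
  at the frontier the received sum is `> 0.995` and the explicit rate `< 10⁻⁶` — recorded, not advertised.
WHAT THIS IS NOT: the star door's rate `(1-ρ)²/(2(4dρ+1))/(D+2)` is a weak LOWER bound on the inverse correlation
length (Dobrushin–Shlosman comparison over vertex stars); «uniform» = one `(m, A)` for every member and every DLR
state; strong-coupling LATTICE statements, nothing about the continuum limit or a Clay-sense mass gap.
-/

noncomputable section

open MeasureTheory ProbabilityTheory Function Finset Real
open scoped NNReal
open Literature.Probability.LatticeModels
open Literature.Probability.LatticeModels.DobrushinMetric (IsLipBound)
open Literature.MathematicalPhysics.QuantumLattice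
open Literature.MathematicalPhysics.QuantumFieldTheory hiding ZdEdge Site
open Literature.MathematicalPhysics.QuantumFieldTheory.Balaban1983to89.StrongCouplingDobrushinWindow
  (OneLinkKRModulus)
open Summit.Ventures.YMGap.DSWindowZd
open Summit.Ventures.YMGap.StarResolventDim (Delta gaugeR doorPoly gaugeR_lt_one_of_door)

namespace Summit.Ventures.YMGap.RobustBall

variable {d N : ℕ}

/-! ### The member: explicit clustering data from a star window bound -/

/-- The star window bound is monotone in the received sum. [folklore] -/
theorem StarWindowBoundZdR.mono_rho {γ : Specification (ZdEdge d) (SUN N)} {D : ℕ} {ρ ρ' : ℝ}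
    {r : SUN N → SUN N → ℝ} (h : StarWindowBoundZdR d N γ D ρ r) (hρ : ρ ≤ ρ') :
    StarWindowBoundZdR d N γ D ρ' r := by
  obtain ⟨K, h0, hsupp, hcontr, hsum⟩ := h
  exact ⟨K, h0, hsupp, hcontr, fun s x hx => (hsum s x hx).trans hρ⟩

/-- `starRate d ρ ≤ 1/2` for `0 ≤ ρ ≤ 1`, hence `e^{starRate d ρ} ≤ 2`. [folklore] -/
theorem exp_starRate_le_two {ρ : ℝ} (hρ0 : 0 ≤ ρ) (hρ1 : ρ ≤ 1) : Real.exp (starRate d ρ) ≤ 2 := by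
  have hs : starRate d ρ ≤ 1 / 2 := by
    unfold starRate
    rw [div_le_iff₀ (by positivity)]
    have h1 : (1 - ρ) ^ 2 ≤ 1 := by nlinarith
    have h2 : (0 : ℝ) ≤ 2 * ρ * ((2 * d : ℕ) : ℝ) := by positivity
    nlinarith
  have hhalf : Real.exp (1 / 2 : ℝ) ≤ 2 := by
    have hpos : 0 < Real.exp (1 / 2 : ℝ) := Real.exp_pos _
    have hsq : Real.exp (1 / 2 : ℝ) * Real.exp (1 / 2) = Real.exp 1 := by
      rw [← Real.exp_add]; norm_num
    nlinarith [Real.exp_one_lt_d9]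
  exact (Real.exp_le_exp.2 hs).trans hhalf

/-- **Explicit clustering data from a star window bound** (the clustering half of ds-2's
`perturbedMassGapAt_of_starWindowBoundZdR`, constants exposed): for a member with continuous own-link terms
supported by `supp` with range `R`, a star window bound for `perturbedYM (fundamentalRep (Fin N)) (N β) W supp` with
locality radius `D ≥ R + 2` and received sum `0 ≤ ρ < 1` gives `PerturbedClustering d N β W supp (starRate d ρ/(D+2))
(16N e^{starRate d ρ})` (`abs_covariance_le_of_starWindowBoundZdR`, `c₁ = 4(2√N)² n² e^{κ}`). [folklore] -/
theorem perturbedClustering_of_starWindowBoundZdR {β ρ : ℝ} {R D : ℕ}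
    {W : Potential (ZdEdge d) (SUN N)} (hWc : ∀ X, Continuous (W X))
    (hWdep : ∀ X, DependsOn (W X) (↑X : Set (ZdEdge d)))
    {supp : Finset (ZdEdge d) → Finset (Finset (ZdEdge d))} (hsupp : W.IsSupportedBy supp)
    (hR : ∀ e, ∀ X ∈ supp {e}, e ∈ X → ∀ y ∈ X, ‖e.1 - y.1‖ ≤ (R : ℝ)) (hD : R + 2 ≤ D)
    (hρ0 : 0 ≤ ρ) (hρ1 : ρ < 1)
    (h : StarWindowBoundZdR d N (perturbedYM (d := d) (fundamentalRep (Fin N)) (N * β) W supp) D ρ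
      suFrobDist) :
    PerturbedClustering d N β W supp (starRate d ρ / (D + 2 : ℕ)) (16 * N * Real.exp (starRate d ρ)) := by
  classical
  haveI : SecondCountableTopology (Matrix (Fin N) (Fin N) ℂ) :=
    inferInstanceAs (SecondCountableTopology (Fin N → Fin N → ℂ))
  haveI : SecondCountableTopology (SUN N) := Topology.IsEmbedding.subtypeVal.secondCountableTopology
  have hW : W.IsAdapted := fun X => ⟨hWdep X, (hWc X).measurable⟩
  have hWb : ∀ X, ∃ C, ∀ U, |W X U| ≤ C := fun X => exists_bound_of_continuous (hWc X)
  have hγ : IsSpecification (perturbedYM (d := d) (fundamentalRep (Fin N)) (N * β) W supp) :=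
    isSpecification_perturbedYM _ (continuous_fundamentalRep (Fin N)) _ hW hWb hsupp
  have hD1 : 1 ≤ D := by omega
  have hloc : ∀ (c : ZdEdge d) (ζ ζ' : LGConfig d (SUN N)), (∀ v ∈ starNbhdZdR D c.1, ζ v = ζ' v) →
      ∀ (f : LGConfig d (SUN N) → ℝ), Measurable f → (∃ B, ∀ σ, |f σ| ≤ B) →
        DependsOn f (starWinZd c : Set (ZdEdge d)) →
        ∫ σ, f σ ∂(perturbedYM (d := d) (fundamentalRep (Fin N)) (N * β) W supp (starWinZd c) ζ) =
          ∫ σ, f σ ∂(perturbedYM (d := d) (fundamentalRep (Fin N)) (N * β) W supp (starWinZd c) ζ') :=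
    fun c ζ ζ' hζ f hfm _ hfdep => perturbed_star_hloc _ (continuous_fundamentalRep (Fin N)) _
      (fun X => (hWc X).measurable) hWdep hsupp hR hD c ζ ζ' hζ f hfm hfdep
  intro μ hμ n F₁ F₂ Λ₁ Λ₂ K₁ K₂ h₁ h₂ _ hF₁ hF₂
  set κ : ℝ := starRate d ρ with hκ
  have hκ0 : 0 < κ := starRate_pos hρ0 hρ1
  have hD2 : (0 : ℝ) < ((D + 2 : ℕ) : ℝ) := by positivity
  have hμ' : IsGibbsMeasure (perturbedYM (d := d) (fundamentalRep (Fin N)) (N * β) W supp) μ := hμ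
  haveI := hμ'.isProbabilityMeasure
  have hA : ∀ a b : SUN N, dist (suEntries a) (suEntries b) ≤ 1 * suFrobDist a b := fun a b => by
    rw [one_mul]; exact dist_suEntries_le_suFrobDist a b
  have key := abs_covariance_le_of_starWindowBoundZdR hγ hD1 hloc hρ0 hρ1 h hμ'
    hF₁.measurable hF₂.measurable hF₁.abs_le hF₂.abs_le hF₁.dependsOn hF₂.dependsOn
    (hF₁.isLipBound zero_le_one hA) (hF₂.isLipBound zero_le_one hA)
  have hK₁ : (0 : ℝ) ≤ K₁ := K₁.2
  have hK₂ : (0 : ℝ) ≤ K₂ := K₂.2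
  have hn₁ : (Λ₁.card : ℝ) ≤ n := by exact_mod_cast h₁
  have hn₂ : (Λ₂.card : ℝ) ≤ n := by exact_mod_cast h₂
  have hsum₁ : ∑ y ∈ Λ₁, (if y ∈ Λ₁ then 1 * (K₁ : ℝ) else 0) ≤ n * K₁ := by
    rw [Finset.sum_ite_of_true (fun y hy => hy), Finset.sum_const, nsmul_eq_mul, one_mul]
    exact mul_le_mul_of_nonneg_right hn₁ hK₁
  have hsum₂ : ∑ y ∈ Λ₂, (if y ∈ Λ₂ then 1 * (K₂ : ℝ) else 0) ≤ n * K₂ := by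
    rw [Finset.sum_ite_of_true (fun y hy => hy), Finset.sum_const, nsmul_eq_mul, one_mul]
    exact mul_le_mul_of_nonneg_right hn₂ hK₂
  have hsum₁0 : 0 ≤ ∑ y ∈ Λ₁, (if y ∈ Λ₁ then 1 * (K₁ : ℝ) else 0) :=
    Finset.sum_nonneg fun y hy => by rw [if_pos hy]; positivity
  have hgeom : Real.exp (-(κ * ⌊setDistEdges Λ₁ Λ₂ / (D + 2 : ℕ)⌋₊)) ≤
      Real.exp κ * Real.exp (-(κ / (D + 2 : ℕ)) * setDistEdges Λ₁ Λ₂) := by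
    rw [← Real.exp_add]
    refine Real.exp_le_exp.2 ?_
    have hfl : setDistEdges Λ₁ Λ₂ / (D + 2 : ℕ) - 1 ≤ (⌊setDistEdges Λ₁ Λ₂ / (D + 2 : ℕ)⌋₊ : ℝ) := by
      have := Nat.lt_floor_add_one (setDistEdges Λ₁ Λ₂ / (D + 2 : ℕ))
      linarith
    have := mul_le_mul_of_nonneg_left hfl hκ0.le
    have e1 : -(κ / (D + 2 : ℕ)) * setDistEdges Λ₁ Λ₂ = -(κ * (setDistEdges Λ₁ Λ₂ / (D + 2 : ℕ))) := by
      field_simp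
    rw [e1]
    linarith
  have h16 : (4 * (2 * Real.sqrt N) ^ 2 : ℝ) = 16 * N := by
    rw [mul_pow, Real.sq_sqrt (Nat.cast_nonneg _)]; ring
  calc |cov[F₁, F₂; μ]|
      ≤ 4 * (2 * Real.sqrt N) ^ 2 * Real.exp (-(κ * ⌊setDistEdges Λ₁ Λ₂ / (D + 2 : ℕ)⌋₊)) *
          (∑ y ∈ Λ₁, (if y ∈ Λ₁ then 1 * (K₁ : ℝ) else 0)) *
          ∑ y ∈ Λ₂, (if y ∈ Λ₂ then 1 * (K₂ : ℝ) else 0) := key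
    _ ≤ 4 * (2 * Real.sqrt N) ^ 2 * (Real.exp κ * Real.exp (-(κ / (D + 2 : ℕ)) * setDistEdges Λ₁ Λ₂)) *
          (n * K₁) * (n * K₂) := by
        gcongr
    _ = 16 * N * Real.exp κ * (n : ℝ) ^ 2 * Real.exp (-(κ / (D + 2 : ℕ)) * setDistEdges Λ₁ Λ₂) *
          ((K₁ : ℝ) * K₂) := by rw [← h16]; ring
    _ ≤ 16 * N * Real.exp κ * (n : ℝ) ^ 2 * Real.exp (-(κ / (D + 2 : ℕ)) * setDistEdges Λ₁ Λ₂) *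
          ((K₁ : ℝ) * K₂ + Real.sqrt (∫ U, F₁ U ^ 2 ∂μ) * Real.sqrt (∫ U, F₂ U ^ 2 ∂μ)) := by
        gcongr
        exact le_add_of_nonneg_right (by positivity)

/-! ### The ball: the uniform mass gap through the robust star door -/

/-- **THE MASS GAP, UNIFORMLY ON THE GAUGE-INVARIANT TIER-1 `ℤ^d` BALL, EXPLICIT RATE AND CONSTANT.** Under the
hypotheses of ds-2's `massGapOnBallZdG_of_robustStar` (dimension `d ≥ 2`, a one-link modulus `OneLinkKRModulus N Rm K`
on `Rm ≥ 2(d−1)|β|`, the robust coefficient `K e^{ε₀}(1 + 2√N ε₁)|β| ≤ c` below the door `doorPoly d c < 1`,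
`λ ≥ √N ε₁`, `θ = (2d−2)c + λ < 1`, received sum `ρ = gaugeR d c + (λ + θ^Kn·4dλ)/(1−θ)`) and a bound `ρ ≤ ρ₀ < 1`:
`UniformMassGapOnBallZdG d N β ε₀ ε₁ R (starRate d ρ₀/(max R 1 + 4)) (32N)` — EVERY member has exactly one DLR state
and EVERY DLR state clusters with this rate and this constant. [folklore] -/
theorem uniformMassGapOnBallZdG_of_robustStar (hd : 2 ≤ d) (hN : 1 ≤ N) {β ε₀ ε₁ Rm K c lam θ ρ ρ₀ : ℝ}
    {R Kn : ℕ} (hK : 0 ≤ K) (hRm : |(N : ℝ) * β| / N * (2 * ((d : ℝ) - 1)) ≤ Rm) (hmod : OneLinkKRModulus N Rm K)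
    (hε₁ : 0 ≤ ε₁) (hc : K * Real.exp ε₀ * (1 + 2 * Real.sqrt N * ε₁) * (|(N : ℝ) * β| / N) ≤ c)
    (hlam : Real.sqrt N * ε₁ ≤ lam) (hθ : θ = (2 * (d : ℝ) - 2) * c + lam) (hθ1 : θ < 1)
    (hcd : doorPoly d c < 1) (hρ : ρ = gaugeR d c + (lam + θ ^ Kn * (4 * d * lam)) / (1 - θ)) (hρ0 : ρ ≤ ρ₀)
    (hρ1 : ρ₀ < 1) :
    UniformMassGapOnBallZdG d N β ε₀ ε₁ R (starRate d ρ₀ / (max R 1 + 4 : ℕ)) (32 * N) := by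
  have hc0 : 0 ≤ c := le_trans (by positivity) hc
  have hlam0 : 0 ≤ lam := le_trans (by positivity) hlam
  have hgR : 0 ≤ gaugeR d c ∧ gaugeR d c < 1 := gaugeR_lt_one_of_door hd hc0 hcd
  have hd2 : (2 : ℝ) ≤ d := by exact_mod_cast hd
  have hθ0 : 0 ≤ θ := by rw [hθ]; nlinarith
  have h1θ : 0 < 1 - θ := by linarith
  have hρ00 : 0 ≤ ρ := by
    rw [hρ]
    refine add_nonneg hgR.1 (div_nonneg (add_nonneg hlam0 ?_) h1θ.le)
    have : 0 ≤ θ ^ Kn := pow_nonneg hθ0 Kn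
    positivity
  have hρ₀0 : 0 ≤ ρ₀ := hρ00.trans hρ0
  have hDpos : (0 : ℝ) < ((max R 1 + 4 : ℕ) : ℝ) := by positivity
  refine ⟨div_pos (starRate_pos hρ₀0 hρ1) hDpos, fun W supp hW => ?_⟩
  have hwin := (starWindowBoundZdR_of_memBallZdG hd hN hK hRm hmod hε₁ hc hlam hθ hθ1 hcd hρ hW).mono_rho hρ0
  have hD : R + 2 ≤ max R 1 + 2 := by omega
  refine ⟨(perturbedMassGapAt_of_starWindowBoundZdR hW.continuous hW.dependsOn hW.supportedBy hW.range hD hρ₀0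
      hρ1 hwin).1, ?_⟩
  have hcl := perturbedClustering_of_starWindowBoundZdR hW.continuous hW.dependsOn hW.supportedBy hW.range hD hρ₀0
    hρ1 hwin
  have hN0 : (0 : ℝ) ≤ N := Nat.cast_nonneg _
  have e4 : (max R 1 + 2 + 2 : ℕ) = max R 1 + 4 := by omega
  rw [e4] at hcl
  refine hcl.mono le_rfl ?_ (by positivity)
  calc 16 * (N : ℝ) * Real.exp (starRate d ρ₀) ≤ 16 * N * 2 := by
        gcongr
        exact exp_starRate_le_two hρ₀0 hρ1.le
    _ = 32 * N := by ring

/-! ### `SU(2)`, `d = 4`: the schema on the quarter modulus and cells with a legible rate -/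

/-- **SCHEMA, `SU(2)`, `d = 4` (ds-2's `su2_massGapOnBallZdG_star`, uniformly)**: decimal majorants `e^{ε₀} ≤ E`,
`√2 ≤ S`, a coefficient `c ≥ E(1 + 2Sε₁)β_W/4`, `λ ≥ Sε₁`, the rational inequalities `doorPoly 4 c < 1`, `6c + λ < 1`,
`gaugeR 4 c + (λ + (6c+λ)^Kn·16λ)/(1 − (6c+λ)) ≤ ρ₀ < 1` ⇒
`UniformMassGapOnBallZdG 4 2 (β_W/4) ε₀ ε₁ R (starRate 4 ρ₀/(max R 1 + 4)) 64`. [folklore] -/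
theorem su2_uniformMassGapOnBallZdG_star (Kn : ℕ) {βW ε₀ ε₁ c lam E S ρ₀ : ℝ} (hβ0 : 0 ≤ βW) (hβ : βW ≤ 2 / 3)
    (hε₁ : 0 ≤ ε₁) (hE : Real.exp ε₀ ≤ E) (hS : Real.sqrt 2 ≤ S) (hc : E * (1 + 2 * S * ε₁) * (βW / 4) ≤ c)
    (hlam : S * ε₁ ≤ lam) (hθ1 : 6 * c + lam < 1) (hcd : doorPoly 4 c < 1)
    (hρ0 : gaugeR 4 c + (lam + (6 * c + lam) ^ Kn * (16 * lam)) / (1 - (6 * c + lam)) ≤ ρ₀) (hρ1 : ρ₀ < 1)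
    (R : ℕ) : UniformMassGapOnBallZdG 4 2 (βW / 4) ε₀ ε₁ R (starRate 4 ρ₀ / (max R 1 + 4 : ℕ)) 64 := by
  have hS0 : 0 ≤ S := (Real.sqrt_nonneg _).trans hS
  have hE0 : 0 ≤ E := (Real.exp_pos _).le.trans hE
  set θ : ℝ := 6 * c + lam with hθ
  set ρ : ℝ := gaugeR 4 c + (lam + θ ^ Kn * (16 * lam)) / (1 - θ) with hρ
  have habs : |((2 : ℕ) : ℝ) * (βW / 4)| / ((2 : ℕ) : ℝ) = βW / 4 := by
    rw [abs_of_nonneg (by positivity)]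
    push_cast
    ring
  have hR : |((2 : ℕ) : ℝ) * (βW / 4)| / ((2 : ℕ) : ℝ) * (2 * (((4 : ℕ) : ℝ) - 1)) ≤ 3 * βW / 2 := by
    rw [habs]; push_cast; linarith
  have hc' : (1 : ℝ) * Real.exp ε₀ * (1 + 2 * Real.sqrt ((2 : ℕ) : ℝ) * ε₁) *
      (|((2 : ℕ) : ℝ) * (βW / 4)| / ((2 : ℕ) : ℝ)) ≤ c := by
    refine le_trans ?_ hc
    have h1 : Real.sqrt ((2 : ℕ) : ℝ) = Real.sqrt 2 := by norm_num
    rw [h1, one_mul, habs]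
    have hb : 0 ≤ βW / 4 := by positivity
    calc Real.exp ε₀ * (1 + 2 * Real.sqrt 2 * ε₁) * (βW / 4) ≤ E * (1 + 2 * Real.sqrt 2 * ε₁) * (βW / 4) := by
          gcongr
      _ ≤ E * (1 + 2 * S * ε₁) * (βW / 4) := by gcongr
  have hlam' : Real.sqrt ((2 : ℕ) : ℝ) * ε₁ ≤ lam := by
    have h1 : Real.sqrt ((2 : ℕ) : ℝ) = Real.sqrt 2 := by norm_num
    rw [h1]; exact le_trans (mul_le_mul_of_nonneg_right hS hε₁) hlam
  have hθ' : θ = (2 * ((4 : ℕ) : ℝ) - 2) * c + lam := by rw [hθ]; push_cast; ring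
  have hρ' : ρ = gaugeR 4 c + (lam + θ ^ Kn * (4 * ((4 : ℕ) : ℝ) * lam)) / (1 - θ) := by rw [hρ]; push_cast; ring
  have h64 : (32 * ((2 : ℕ) : ℝ) : ℝ) = 64 := by norm_num
  rw [← h64]
  exact uniformMassGapOnBallZdG_of_robustStar (d := 4) (N := 2) (by norm_num) (by norm_num) zero_le_one hR
    (su2_quarterModulus hβ) hε₁ hc' hlam' hθ' hθ1 hcd hρ' hρ0 hρ1

/-- **CELL `β_W = 1/8`, QUARTER RADIUS `(ε₀, ε₁) = (37/500, 37/1000)`**: received sum `≤ 7/20` ⇒ EVERY member of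
`MemBallZdG (37/500) (37/1000) R` at 't Hooft `1/32` has one DLR state clustering at rate `starRate 4 (7/20)/(max R 1 + 4)`
(`= (169/5280)/(max R 1 + 4) ≥ (1/32)/(max R 1 + 4)`) with constant `64 n²` (certificate `c = 9293/250000`,
`λ = 52327/1000000`, `E = T₄(37/500)`). [folklore] -/
theorem su2_uniformStar_oneEighth_quarterRadius (R : ℕ) :
    UniformMassGapOnBallZdG 4 2 (1 / 32) (37 / 500) (37 / 1000) R ((1 / 32 : ℝ) / (max R 1 + 4 : ℕ)) 64 := by
  have e1 : (1 / 8 : ℝ) / 4 = 1 / 32 := by norm_num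
  have h := su2_uniformMassGapOnBallZdG_star 20 (βW := 1 / 8) (ε₀ := 37 / 500) (ε₁ := 37 / 1000)
    (c := 9293 / 250000) (lam := 52327 / 1000000) (ρ₀ := 7 / 20) (by norm_num) (by norm_num) (by norm_num)
    (exp_le_taylor4 (x := 37 / 500) (by norm_num) (by norm_num)) sqrt_two_le (by norm_num) (by norm_num)
    (by norm_num) (by unfold doorPoly; norm_num) (by unfold gaugeR Delta; norm_num) (by norm_num) R
  rw [e1] at h
  have hrate : (1 / 32 : ℝ) ≤ starRate 4 (7 / 20) := by unfold starRate; norm_num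
  have hD : (0 : ℝ) < ((max R 1 + 4 : ℕ) : ℝ) := by positivity
  exact h.mono le_rfl le_rfl le_rfl (by positivity) (div_le_div_of_nonneg_right hrate hD.le) le_rfl (by norm_num)

/-- **CELL `β_W = 1/8`, HALF RADIUS `(ε₀, ε₁) = (37/250, 37/500)`**: received sum `≤ 13/25` ⇒ rate
`(1/81)/(max R 1 + 4)` (`starRate 4 (13/25) = 72/5825`), constant `64 n²` (certificate `c = 2191/50000`, `λ = 104653/1000000`).
[folklore] -/
theorem su2_uniformStar_oneEighth_halfRadius (R : ℕ) :
    UniformMassGapOnBallZdG 4 2 (1 / 32) (37 / 250) (37 / 500) R ((1 / 81 : ℝ) / (max R 1 + 4 : ℕ)) 64 := by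
  have e1 : (1 / 8 : ℝ) / 4 = 1 / 32 := by norm_num
  have h := su2_uniformMassGapOnBallZdG_star 20 (βW := 1 / 8) (ε₀ := 37 / 250) (ε₁ := 37 / 500)
    (c := 2191 / 50000) (lam := 104653 / 1000000) (ρ₀ := 13 / 25) (by norm_num) (by norm_num) (by norm_num)
    (exp_le_taylor4 (x := 37 / 250) (by norm_num) (by norm_num)) sqrt_two_le (by norm_num) (by norm_num)
    (by norm_num) (by unfold doorPoly; norm_num) (by unfold gaugeR Delta; norm_num) (by norm_num) R
  rw [e1] at h
  have hrate : (1 / 81 : ℝ) ≤ starRate 4 (13 / 25) := by unfold starRate; norm_num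
  have hD : (0 : ℝ) < ((max R 1 + 4 : ℕ) : ℝ) := by positivity
  exact h.mono le_rfl le_rfl le_rfl (by positivity) (div_le_div_of_nonneg_right hrate hD.le) le_rfl (by norm_num)

/-- **CELL `β_W = 1/4`, HALF RADIUS `(ε₀, ε₁) = (11/200, 11/400)`** — beyond the single-link threshold `2/9`: received sum
`≤ 3/4` ⇒ rate `(1/416)/(max R 1 + 4)`, constant `64 n²` (certificate `c = 71171/1000000`, `λ = 9723/250000`). [folklore] -/
theorem su2_uniformStar_oneQuarter_halfRadius (R : ℕ) :
    UniformMassGapOnBallZdG 4 2 (1 / 16) (11 / 200) (11 / 400) R ((1 / 416 : ℝ) / (max R 1 + 4 : ℕ)) 64 := by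
  have e1 : (1 / 4 : ℝ) / 4 = 1 / 16 := by norm_num
  have h := su2_uniformMassGapOnBallZdG_star 20 (βW := 1 / 4) (ε₀ := 11 / 200) (ε₁ := 11 / 400)
    (c := 71171 / 1000000) (lam := 9723 / 250000) (ρ₀ := 3 / 4) (by norm_num) (by norm_num) (by norm_num)
    (exp_le_taylor4 (x := 11 / 200) (by norm_num) (by norm_num)) sqrt_two_le (by norm_num) (by norm_num)
    (by norm_num) (by unfold doorPoly; norm_num) (by unfold gaugeR Delta; norm_num) (by norm_num) R
  rw [e1] at h
  have hrate : (1 / 416 : ℝ) ≤ starRate 4 (3 / 4) := by unfold starRate; norm_num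
  have hD : (0 : ℝ) < ((max R 1 + 4 : ℕ) : ℝ) := by positivity
  exact h.mono le_rfl le_rfl le_rfl (by positivity) (div_le_div_of_nonneg_right hrate hD.le) le_rfl (by norm_num)

/-! ### The landed frontier cells, uniformly (rate explicit in the proof, tiny at the frontier) -/

/-- **Frontier cells in uniform form**: from the schema with `ρ₀ =` the certificate's received-sum bound itself one gets
ONE rate and ONE constant for the whole ball and every range (rate `starRate 4 ρ₀/(max R 1 + 4)`). [folklore] -/
theorem su2_uniformStar_exists (Kn : ℕ) {βW ε₀ ε₁ c lam E S : ℝ} (hβ0 : 0 ≤ βW) (hβ : βW ≤ 2 / 3)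
    (hε₁ : 0 ≤ ε₁) (hE : Real.exp ε₀ ≤ E) (hS : Real.sqrt 2 ≤ S) (hc : E * (1 + 2 * S * ε₁) * (βW / 4) ≤ c)
    (hlam : S * ε₁ ≤ lam) (hθ1 : 6 * c + lam < 1) (hcd : doorPoly 4 c < 1)
    (hρ1 : gaugeR 4 c + (lam + (6 * c + lam) ^ Kn * (16 * lam)) / (1 - (6 * c + lam)) < 1) :
    ∃ m : ℝ, 0 < m ∧ ∀ R : ℕ, UniformMassGapOnBallZdG 4 2 (βW / 4) ε₀ ε₁ R (m / (max R 1 + 4 : ℕ)) 64 := by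
  refine ⟨starRate 4 (gaugeR 4 c + (lam + (6 * c + lam) ^ Kn * (16 * lam)) / (1 - (6 * c + lam))), ?_,
    fun R => su2_uniformMassGapOnBallZdG_star Kn hβ0 hβ hε₁ hE hS hc hlam hθ1 hcd le_rfl hρ1 R⟩
  have h := su2_uniformMassGapOnBallZdG_star Kn hβ0 hβ hε₁ hE hS hc hlam hθ1 hcd le_rfl hρ1 0
  have hD : (0 : ℝ) < ((max 0 1 + 4 : ℕ) : ℝ) := by positivity
  have := h.1
  rwa [div_pos_iff_of_pos_right hD] at this

/-- Frontier cell `(β_W, ε) = (1/8, 37/250)` (ds-2's `su2_massGapOnBallZdG_star_oneEighth`), uniformly. [folklore] -/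
theorem su2_uniformStar_frontier_oneEighth :
    ∃ m : ℝ, 0 < m ∧ ∀ R : ℕ, UniformMassGapOnBallZdG 4 2 (1 / 32) (37 / 125) (37 / 250) R (m / (max R 1 + 4 : ℕ)) 64 := by
  have e1 : (1 / 8 : ℝ) / 4 = 1 / 32 := by norm_num
  rw [← e1]
  exact su2_uniformStar_exists 20 (βW := 1 / 8) (ε₀ := 37 / 125) (ε₁ := 37 / 250) (c := 59603 / 1000000)
    (lam := 41861 / 200000) (by norm_num) (by norm_num) (by norm_num) exp_le_37_125_star sqrt_two_le (by norm_num)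
    (by norm_num) (by norm_num) (by unfold doorPoly; norm_num) (by unfold gaugeR Delta; norm_num)

/-- Frontier cell `(β_W, ε) = (1/4, 11/200)` (ds-2's `su2_massGapOnBallZdG_star_oneQuarter`), uniformly. [folklore] -/
theorem su2_uniformStar_frontier_oneQuarter :
    ∃ m : ℝ, 0 < m ∧ ∀ R : ℕ, UniformMassGapOnBallZdG 4 2 (1 / 16) (11 / 100) (11 / 200) R (m / (max R 1 + 4 : ℕ)) 64 := by
  have e1 : (1 / 4 : ℝ) / 4 = 1 / 16 := by norm_num
  rw [← e1]
  exact su2_uniformStar_exists 20 (βW := 1 / 4) (ε₀ := 11 / 100) (ε₁ := 11 / 200) (c := 80621 / 1000000)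
    (lam := 77783 / 1000000) (by norm_num) (by norm_num) (by norm_num) exp_le_11_100_star sqrt_two_le (by norm_num)
    (by norm_num) (by norm_num) (by unfold doorPoly; norm_num) (by unfold gaugeR Delta; norm_num)

/-- Frontier cell `(β_W, ε) = (1/3, 3/250)` (ds-2's `su2_massGapOnBallZdG_star_oneThird`, the highest `ℤ⁴` mass-gap coupling
on a ball of actions in the tree), uniformly. [folklore] -/
theorem su2_uniformStar_frontier_oneThird :
    ∃ m : ℝ, 0 < m ∧ ∀ R : ℕ, UniformMassGapOnBallZdG 4 2 (1 / 12) (3 / 125) (3 / 250) R (m / (max R 1 + 4 : ℕ)) 64 := by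
  have e1 : (1 / 3 : ℝ) / 4 = 1 / 12 := by norm_num
  rw [← e1]
  exact su2_uniformStar_exists 20 (βW := 1 / 3) (ε₀ := 3 / 125) (ε₁ := 3 / 250) (c := 17651 / 200000)
    (lam := 16971 / 1000000) (by norm_num) (by norm_num) (by norm_num) exp_le_3_125_star sqrt_two_le (by norm_num)
    (by norm_num) (by norm_num) (by unfold doorPoly; norm_num) (by unfold gaugeR Delta; norm_num)

/-- **UP TO `β_W = 1/3`, uniformly**: ONE `(m, A)` for every `0 ≤ β_W ≤ 1/3`, every member of `MemBallZdG (3/125) (3/250) R`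
and every DLR state (the certificate is monotone in `β_W`). [folklore] -/
theorem su2_uniformStar_upTo_oneThird :
    ∃ m : ℝ, 0 < m ∧ ∀ βW : ℝ, 0 ≤ βW → βW ≤ 1 / 3 → ∀ R : ℕ,
      UniformMassGapOnBallZdG 4 2 (βW / 4) (3 / 125) (3 / 250) R (m / (max R 1 + 4 : ℕ)) 64 := by
  set ρ₀ : ℝ := gaugeR 4 (17651 / 200000) +
    (16971 / 1000000 + (6 * (17651 / 200000) + 16971 / 1000000) ^ 20 * (16 * (16971 / 1000000))) /
      (1 - (6 * (17651 / 200000) + 16971 / 1000000)) with hρ₀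
  have hρ1 : ρ₀ < 1 := by rw [hρ₀]; unfold gaugeR Delta; norm_num
  have hρ00 : 0 ≤ ρ₀ := by rw [hρ₀]; unfold gaugeR Delta; norm_num
  refine ⟨starRate 4 ρ₀, starRate_pos hρ00 hρ1, fun βW h0 h r => ?_⟩
  refine su2_uniformMassGapOnBallZdG_star 20 (ε₀ := 3 / 125) (ε₁ := 3 / 250) (c := 17651 / 200000)
    (lam := 16971 / 1000000) (E := 1024291 / 1000000) (S := 1.41422) h0 (h.trans (by norm_num)) (by norm_num)
    exp_le_3_125_star sqrt_two_le ?_ (by norm_num) (by norm_num) (by unfold doorPoly; norm_num) le_rfl hρ1 r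
  calc (1024291 / 1000000 : ℝ) * (1 + 2 * 1.41422 * (3 / 250)) * (βW / 4)
      ≤ 1024291 / 1000000 * (1 + 2 * 1.41422 * (3 / 250)) * ((1 / 3) / 4) := by gcongr
    _ ≤ 17651 / 200000 := by norm_num

end Summit.Ventures.YMGap.RobustBall

end
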